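import Summits.ValiantsHypothesis.ValiantsHypothesis.Theorems.RigidityForcesSymmetryGrenetFirstOrderRankRigidOverlapPoint

/-!
# Route RigidityForcesSymmetry — `GrenetFirstOrderRankRigid` (item stmt-ValiantsHypothesis-21029),
line `grenet_gauge`: stub `stub_linearRigid`, step 5 (block I>, part 4) — backward-dominated overlap
designs

For the crux line `Cruxes/GrenetFirstOrderRankRigid/Lines/grenet_gauge.lean` (blueprint §5, type I>;
interface `…BLOCKS.md`, deliverable (D-PQ)).  Mirror image of `…OverlapTermFwd`: an overlap design
`(d₁, d₂)` for a tail entry `(S, T, (p, |S|))` (arc `S → U`) and its head partner `(U, T + p', (p', |T|))`,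
`|T| ≤ |S|`, `T ⊄ U`, is BACKWARD-DOMINATED if on the overlap every `d₁`-cell has its row swept later by
`d₂` (`d₁ c = d₂ c'`, `c' ≥ c`) and every `d₂`-cell has its row outside `U` or swept earlier by `d₁`.
`grenet_overlapTerm_bwd`: at the point of such a design a term of the tangency identity with the row and
column weights of the block evaluates to `-(entry)` if it is one of the two entries and to `0` otherwise
(the backward sweep pins the column vertex, the row weights and the forward sweep — dominated modulo the
complement of the row vertex — the rest).  Consumed by `grenet_overlap_PQ_of_design'` (`…OverlapDesign`).
No new definitions.  VP ≠ VNP is not moved by this file.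
-/

noncomputable section

open MvPolynomial Matrix Finset

namespace Summit.ValiantsHypothesis.Theorems.RigidityForcesSymmetry.GrenetGauge

open Literature.Computability.AlgebraicComplexity

section OverlapTermBwd

variable {k : Type*} [CommRing k] {n N : ℕ} (e : Finset (Fin n) ≃ Fin (N + 1))

/-- Indicator of non-membership in `insert a T`, `a ∉ T`, as naturals. [folklore] -/
theorem ite_not_mem_insert_eq {α : Type*} [DecidableEq α] (T : Finset α) {a : α} (ha : a ∉ T) (x : α) :
    (if x ∈ insert a T then (0 : ℕ) else 1) + (if x = a then 1 else 0) = (if x ∈ T then 0 else 1) := by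
  by_cases h1 : x = a
  · subst h1
    simp [ha]
  · simp [Finset.mem_insert, h1]

/-- **Terms of an overlap block at a backward-dominated design.**  With the data of
`grenet_overlap_PQ_of_design'` and the 0/1 point `P` of the design, a term `(i'', j'', v'')` of the
tangency identity carrying the row weights (`hrow`) and the column weights (`hcol`) of the block of the
tail entry `(i, j, v)` evaluates to `-(A'_{v''} i'' j'')` if it is the tail entry or its head partner
`(i', j', v')`, and to `0` otherwise. [cite: Grenet2011, Thm. 1] -/
theorem grenet_overlapTerm_bwd (A' : Fin n × Fin n → Matrix (Fin N) (Fin N) k)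
    (hsupp : ∀ (w : Fin n × Fin n) (a b : Fin N), A' w a b ≠ 0 →
      (w.1 ∉ e.symm ((e univ).succAbove a) ∧ (w.2 : ℕ) = (e.symm ((e univ).succAbove a)).card) ∨
      (w.1 ∈ e.symm ((e ∅).succAbove b) ∧ (e.symm ((e ∅).succAbove b)).card = (w.2 : ℕ) + 1))
    {i j : Fin N} {v : Fin n × Fin n} {i' j' : Fin N} {v' : Fin n × Fin n}
    (htail : v.1 ∉ e.symm ((e univ).succAbove i) ∧ (v.2 : ℕ) = (e.symm ((e univ).succAbove i)).card)
    (hhead : v'.1 ∈ e.symm ((e ∅).succAbove j') ∧ (e.symm ((e ∅).succAbove j')).card = (v'.2 : ℕ) + 1)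
    (hU : insert v.1 (e.symm ((e univ).succAbove i)) = e.symm ((e univ).succAbove i'))
    (hT : e.symm ((e ∅).succAbove j) = (e.symm ((e ∅).succAbove j')).erase v'.1)
    (hle : (e.symm ((e ∅).succAbove j)).card ≤ (e.symm ((e univ).succAbove i)).card)
    (hB : ¬ e.symm ((e ∅).succAbove j) ⊆ e.symm ((e univ).succAbove i'))
    (d₁ d₂ : Fin n → Fin n)
    (h1inj : ∀ c c' : Fin n, (c : ℕ) ≤ (e.symm ((e univ).succAbove i)).card →
      (c' : ℕ) ≤ (e.symm ((e univ).succAbove i)).card → d₁ c = d₁ c' → c = c')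
    (h1img : (univ.filter fun c : Fin n => (c : ℕ) ≤ (e.symm ((e univ).succAbove i)).card).image d₁
      = e.symm ((e univ).succAbove i'))
    (h1top : d₁ v.2 = v.1)
    (h2inj : ∀ c c' : Fin n, (e.symm ((e ∅).succAbove j)).card ≤ (c : ℕ) →
      (e.symm ((e ∅).succAbove j)).card ≤ (c' : ℕ) → d₂ c = d₂ c' → c = c')
    (h2avoid : ∀ c : Fin n, (e.symm ((e ∅).succAbove j)).card ≤ (c : ℕ) → d₂ c ∉ e.symm ((e ∅).succAbove j))
    (h2bot : d₂ v'.2 = v'.1)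
    (hdom1 : ∀ c : Fin n, (e.symm ((e ∅).succAbove j)).card ≤ (c : ℕ) →
      (c : ℕ) ≤ (e.symm ((e univ).succAbove i)).card →
        d₂ c ∉ e.symm ((e univ).succAbove i') ∨ ∃ c' : Fin n, (c' : ℕ) ≤ (c : ℕ) ∧ d₁ c' = d₂ c)
    (hdom2 : ∀ c : Fin n, (e.symm ((e ∅).succAbove j)).card ≤ (c : ℕ) →
      (c : ℕ) ≤ (e.symm ((e univ).succAbove i)).card → ∃ c' : Fin n, (c : ℕ) ≤ (c' : ℕ) ∧ d₂ c' = d₁ c)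
    (P : Fin n × Fin n → Prop) [DecidablePred P]
    (hPiff : ∀ w : Fin n × Fin n, P w ↔
      (((w.2 : ℕ) ≤ (e.symm ((e univ).succAbove i)).card ∧ d₁ w.2 = w.1) ∨
        ((e.symm ((e ∅).succAbove j)).card ≤ (w.2 : ℕ) ∧ d₂ w.2 = w.1)))
    (i'' j'' : Fin N) (v'' : Fin n × Fin n)
    (hrow : ∀ j₁ : Fin n, (if j₁ ∈ e.symm ((e univ).succAbove i'') then 1 else 0)
        + (if j₁ ∈ e.symm ((e ∅).succAbove j'') then 0 else 1) + (if j₁ = v''.1 then 1 else 0)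
      = (if j₁ ∈ e.symm ((e univ).succAbove i) then 1 else 0)
        + (if j₁ ∈ e.symm ((e ∅).succAbove j) then 0 else 1) + (if j₁ = v.1 then (1 : ℕ) else 0))
    (hcol : ∀ c, c < n → (if c < (e.symm ((e univ).succAbove i'')).card then 1 else 0)
        + (if (e.symm ((e ∅).succAbove j'')).card ≤ c then 1 else 0) + (if c = (v''.2 : ℕ) then 1 else 0)
      = (if c < (e.symm ((e univ).succAbove i)).card then 1 else 0)
        + (if (e.symm ((e ∅).succAbove j)).card ≤ c then 1 else 0)
        + (if c = (e.symm ((e univ).succAbove i)).card then (1 : ℕ) else 0)) :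
    eval (fun w : Fin n × Fin n => if P w then (1 : k) else 0) (C (A' v'' i'' j'') *
        (perPoly (Fin n) k * (1 - Grenet.adj k n).adjugate (e.symm ((e ∅).succAbove j''))
            (e.symm ((e univ).succAbove i'')) * X v''
          - (1 - Grenet.adj k n).adjugate ∅ (e.symm ((e univ).succAbove i'')) * X v''
            * (1 - Grenet.adj k n).adjugate (e.symm ((e ∅).succAbove j'')) univ))
      = -(A' v'' i'' j'' * if ((i'', j'', v'') = (i, j, v) ∨ (i'', j'', v'') = (i', j', v')) then 1 else 0) := by
  classical
  set S := e.symm ((e univ).succAbove i) with hSdef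
  set T := e.symm ((e ∅).succAbove j) with hTdef
  set U := e.symm ((e univ).succAbove i') with hUdef
  set T' := e.symm ((e ∅).succAbove j') with hT'def
  set S'' := e.symm ((e univ).succAbove i'') with hS''def
  set T'' := e.symm ((e ∅).succAbove j'') with hT''def
  have hRinj : ∀ a b : Fin N, e.symm ((e univ).succAbove a) = e.symm ((e univ).succAbove b) → a = b :=
    fun a b h => Fin.succAbove_right_injective (e.symm.injective h)
  have hCinj : ∀ a b : Fin N, e.symm ((e ∅).succAbove a) = e.symm ((e ∅).succAbove b) → a = b :=
    fun a b h => Fin.succAbove_right_injective (e.symm.injective h)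
  obtain ⟨hpS, hq⟩ := htail
  obtain ⟨hp'T', hq'⟩ := hhead
  have hp'T : v'.1 ∉ T := by rw [hT]; exact Finset.notMem_erase _ _
  have hT'eq : T' = insert v'.1 T := by rw [hT, Finset.insert_erase hp'T']
  have hUcard : U.card = S.card + 1 := by rw [← hU, Finset.card_insert_of_notMem hpS]
  have hTcard : T.card = (v'.2 : ℕ) := by
    have h1 := Finset.card_erase_of_mem hp'T'
    rw [← hT] at h1
    omega
  have hUn : U.card < n := by
    rw [hUdef]
    have h1 := (Finset.card_lt_iff_ne_univ _).mpr (grenet_row_ne_univ e i')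
    rwa [Fintype.card_fin] at h1
  have hSn : S.card + 1 < n := by rw [← hUcard]; exact hUn
  have hpU : v.1 ∈ U := by rw [← hU]; exact Finset.mem_insert_self _ _
  have hTT' : T ⊆ T' := by rw [hT'eq]; exact Finset.subset_insert _ _
  have himgS : (univ.filter fun c : Fin n => (c : ℕ) < S.card).image d₁ = S := by
    ext p
    simp only [Finset.mem_image, Finset.mem_filter, Finset.mem_univ, true_and]
    constructor
    · rintro ⟨c, hc, rfl⟩
      have hcU : d₁ c ∈ U := by
        rw [← h1img]
        exact Finset.mem_image.mpr ⟨c, Finset.mem_filter.mpr ⟨Finset.mem_univ _, hc.le⟩, rfl⟩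
      rw [← hU, Finset.mem_insert] at hcU
      rcases hcU with h | h
      · exfalso
        rw [← h1top] at h
        have := h1inj c v.2 hc.le (by omega) h
        rw [this] at hc
        omega
      · exact h
    · intro hp
      have hpU' : p ∈ U := by rw [← hU]; exact Finset.mem_insert_of_mem hp
      rw [← h1img] at hpU'
      obtain ⟨c, hc, rfl⟩ := Finset.mem_image.mp hpU'
      have hc' := (Finset.mem_filter.mp hc).2
      refine ⟨c, ?_, rfl⟩
      rcases hc'.lt_or_eq with h | h
      · exact h
      · exfalso
        have hcv : c = v.2 := Fin.ext (by rw [h, hq])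
        rw [hcv, h1top] at hp
        exact hpS hp
  have himgU : (univ.filter fun c : Fin n => (c : ℕ) < S.card + 1).image d₁ = U := by
    rw [← h1img]
    congr 1
    exact Finset.filter_congr fun c _ => Nat.lt_succ_iff
  have hPiff' : ∀ p c : Fin n, P (p, c) ↔
      (((c : ℕ) ≤ S.card ∧ d₁ c = p) ∨ (T.card ≤ (c : ℕ) ∧ d₂ c = p)) := fun p c => hPiff (p, c)
  have hprim1 : ∀ c : Fin n, (c : ℕ) ≤ S.card → P (d₁ c, c) := fun c hc => (hPiff _).mpr (Or.inl ⟨hc, rfl⟩)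
  have hprim2 : ∀ c : Fin n, T.card ≤ (c : ℕ) → P (d₂ c, c) := fun c hc => (hPiff _).mpr (Or.inr ⟨hc, rfl⟩)
  have hSU : S ⊆ U := fun x hx => by rw [← hU]; exact Finset.mem_insert_of_mem hx
  have hdomF : ∀ p c : Fin n, (c : ℕ) ≤ S.card → P (p, c) → p ∈ U → p ≠ d₁ c →
      ∃ c' : Fin n, (c' : ℕ) < (c : ℕ) ∧ d₁ c' = p := by
    intro p c hc hP hpU' hne
    rcases (hPiff' _ _).mp hP with ⟨-, h⟩ | ⟨htc, h⟩
    · exact absurd h.symm hne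
    · rcases hdom1 c htc hc with h' | ⟨c', hc'le, hc'⟩
      · exact absurd (h ▸ h') (not_not_intro hpU')
      · refine ⟨c', ?_, by rw [hc', h]⟩
        rcases hc'le.lt_or_eq with h'' | h''
        · exact h''
        · exfalso
          have hcc : c' = c := Fin.ext h''
          rw [hcc] at hc'
          exact hne (by rw [← h, ← hc'])
  have hdomB : ∀ p c : Fin n, T.card ≤ (c : ℕ) → P (p, c) → p ≠ d₂ c →
      ∃ c' : Fin n, (c : ℕ) < (c' : ℕ) ∧ d₂ c' = p := by
    intro p c hc hP hne
    rcases (hPiff' _ _).mp hP with ⟨hcs, h⟩ | ⟨-, h⟩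
    · obtain ⟨c', hc'le, hc'⟩ := hdom2 c hc hcs
      refine ⟨c', ?_, by rw [hc', h]⟩
      rcases hc'le.lt_or_eq with h'' | h''
      · exact h''
      · exfalso
        have hcc : c = c' := Fin.ext h''
        rw [← hcc] at hc'
        exact hne (by rw [← h, ← hc'])
    · exact absurd h.symm hne
  have hTc : Tᶜ = (univ.filter fun c : Fin n => T.card ≤ (c : ℕ)).image d₂ :=
    compl_eq_image_of_avoid d₂ T h2inj h2avoid
  by_cases hA0 : A' v'' i'' j'' = 0
  · rw [hA0, map_mul, eval_C, zero_mul, zero_mul, neg_zero]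
  have hth : (v''.1 ∉ S'' ∧ (v''.2 : ℕ) = S''.card) ∨ (v''.1 ∈ T'' ∧ T''.card = (v''.2 : ℕ) + 1) := by
    rw [hS''def, hT''def]
    exact hsupp v'' i'' j'' hA0
  have hshape := overlap_column_shape hle hSn v''.2.isLt hcol
    (hth.imp (fun h' => h'.2) (fun h' => h'.2))
  obtain ⟨b₀, hb₀T, hb₀U⟩ := Finset.not_subset.mp hB
  have hb₀ : b₀ ∈ T'' ∧ b₀ ∉ S'' := by
    have h1 := hrow b₀
    have hb₀S : b₀ ∉ S := fun h' => hb₀U (hU ▸ Finset.mem_insert_of_mem h')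
    have hb₀v : b₀ ≠ v.1 := fun h' => hb₀U (h' ▸ hpU)
    rw [if_neg hb₀S, if_pos hb₀T, if_neg hb₀v] at h1
    constructor
    · by_contra h'; rw [if_neg h'] at h1; omega
    · intro h'; rw [if_pos h'] at h1; omega
  have hns : ¬ T'' ⊆ S'' := fun h' => hb₀.2 (h' hb₀.1)
  rw [map_mul, eval_C, map_sub, map_mul, map_mul, map_mul, map_mul,
    grenet_W_eq_zero_of_not_subset k hns, map_zero, mul_zero, zero_mul, zero_sub, eval_X, mul_neg,
    neg_inj]
  congr 1
  have hgoal : ∀ F : k, (F ≠ 0 → ((i'', j'', v'') = (i, j, v) ∨ (i'', j'', v'') = (i', j', v'))) →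
      ((i'', j'', v'') = (i, j, v) → F = 1) → ((i'', j'', v'') = (i', j', v') → F = 1) →
      F = if ((i'', j'', v'') = (i, j, v) ∨ (i'', j'', v'') = (i', j', v')) then 1 else 0 := by
    intro F h0 hρ hκ
    by_cases hx' : (i'', j'', v'') = (i, j, v) ∨ (i'', j'', v'') = (i', j', v')
    · rw [if_pos hx']
      rcases hx' with hx' | hx'
      · exact hρ hx'
      · exact hκ hx'
    · rw [if_neg hx']
      by_contra hF
      exact hx' (h0 hF)
  refine hgoal _ ?_ ?_ ?_
  · -- a nonzero term is one of the two entries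
    intro hF
    have hF1 : eval (fun w : Fin n × Fin n => if P w then (1 : k) else 0)
        ((1 - Grenet.adj k n).adjugate ∅ S'') ≠ 0 := fun h' => hF (by rw [h', zero_mul, zero_mul])
    have hF2 : P v'' := by
      by_contra h'
      exact hF (by rw [if_neg h', mul_zero, zero_mul])
    have hF3 : eval (fun w : Fin n × Fin n => if P w then (1 : k) else 0)
        ((1 - Grenet.adj k n).adjugate T'' univ) ≠ 0 := fun h' => hF (by rw [h', mul_zero])
    rcases hshape with ⟨hs, ht, hqq⟩ | ⟨hs, ht, hqq⟩
    · -- TAIL-LIKE: `|S''| = |S|`, `|T''| = |T|`, `v''.2 = |S|`; the rank constraint makes it a tail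
      have htl : v''.1 ∉ S'' := by
        rcases hth with h' | h'
        · exact h'.1
        · exfalso; omega
      have hv2 : v''.2 = v.2 := Fin.ext (by rw [hqq, hq])
      rw [evalSweep_grenet_W_univ k P d₂ T'' (fun c hc => hprim2 c (by omega))
        (fun p c hc hP _ hne => hdomB p c (by omega) hP hne), ht] at hF3
      have hcond : (∀ c c' : Fin n, T.card ≤ (c : ℕ) → T.card ≤ (c' : ℕ) → d₂ c = d₂ c' → c = c') ∧
          ∀ c : Fin n, T.card ≤ (c : ℕ) → d₂ c ∉ T'' := by
        by_contra h'
        exact hF3 (if_neg h')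
      have hT''T : T'' = T := by
        have h1 : T''ᶜ = (univ.filter fun c : Fin n => T''.card ≤ (c : ℕ)).image d₂ :=
          compl_eq_image_of_avoid d₂ T'' (by rw [ht]; exact h2inj) (by rw [ht]; exact hcond.2)
        rw [ht] at h1
        exact compl_inj_iff.mp (h1.trans hTc.symm)
      have hj : j'' = j := hCinj _ _ (by rw [← hT''def, ← hTdef]; exact hT''T)
      have hrow' : ∀ j₁ : Fin n, (if j₁ ∈ S'' then 1 else 0) + (if j₁ = v''.1 then 1 else 0)
          = (if j₁ ∈ S then 1 else 0) + (if j₁ = v.1 then (1 : ℕ) else 0) := by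
        intro j₁
        have h1 := hrow j₁
        rw [hT''T] at h1
        omega
      by_cases hd1 : d₁ v''.2 = v''.1
      · -- the cell of `v''` is the top cell of `d₁`: it is the tail entry
        have hv1 : v''.1 = v.1 := by rw [← hd1, hv2, h1top]
        have hvv : v'' = v := Prod.ext hv1 hv2
        have hS''S : S'' = S := by
          ext j₁
          have h1 := hrow' j₁
          rw [hv1] at h1
          by_cases h2 : j₁ ∈ S'' <;> by_cases h3 : j₁ ∈ S <;>
            simp only [h2, h3, if_true, if_false, iff_true, iff_false, not_true] at h1 ⊢ <;>
            omega
        have hi : i'' = i := hRinj _ _ (by rw [← hS''def, ← hSdef]; exact hS''S)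
        left
        rw [hi, hj, hvv]
      · -- otherwise it is the `d₂`-cell of the top overlap column; the forward sweep (the row vertex lies
        -- inside `U`) pins `S'' = S`, and then the row weights force `v''.1 = p`: contradiction
        exfalso
        rcases (hPiff _).mp hF2 with ⟨-, hd⟩ | ⟨-, hd⟩
        · exact hd1 hd
        have hS''U : S'' ⊆ U := by
          intro j₁ hj₁
          have h1 := hrow' j₁
          rw [if_pos hj₁, ← ite_mem_insert_eq S hpS, hU] at h1
          by_contra h'
          rw [if_neg h'] at h1
          omega
        rw [evalSweep_grenet_W_empty k P d₁ S'' (fun c hc => hprim1 c (by omega))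
          (fun p c hc hP hpS'' hne => hdomF p c (by omega) hP (hS''U hpS'') hne), hs] at hF1
        have hS''S : S'' = S := by
          by_contra h'
          exact hF1 (if_neg fun h'' => h' (h''.2.symm.trans himgS))
        have h1 := hrow' v''.1
        rw [hS''S, if_pos rfl] at h1
        have hv1 : v''.1 = v.1 := by by_contra h'; rw [if_neg h'] at h1; omega
        exact hd1 (by rw [hv2, h1top, hv1])
    · -- HEAD-LIKE: `|S''| = |S| + 1`, `|T''| = |T| + 1`, `v''.2 = |T|`; the rank constraint makes it a head
      have hhd : v''.1 ∈ T'' := by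
        rcases hth with h' | h'
        · exfalso; omega
        · exact h'.1
      have hv2 : v''.2 = v'.2 := Fin.ext (by rw [hqq, hTcard])
      have hT'card : T'.card = T.card + 1 := by rw [hT'eq, Finset.card_insert_of_notMem hp'T]
      rw [evalSweep_grenet_W_univ k P d₂ T'' (fun c hc => hprim2 c (by omega))
        (fun p c hc hP _ hne => hdomB p c (by omega) hP hne), ht] at hF3
      have hcond : (∀ c c' : Fin n, T.card + 1 ≤ (c : ℕ) → T.card + 1 ≤ (c' : ℕ) → d₂ c = d₂ c' → c = c') ∧
          ∀ c : Fin n, T.card + 1 ≤ (c : ℕ) → d₂ c ∉ T'' := by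
        by_contra h'
        exact hF3 (if_neg h')
      have hT'avoid : ∀ c : Fin n, T'.card ≤ (c : ℕ) → d₂ c ∉ T' := by
        intro c hc
        rw [hT'card] at hc
        rw [hT'eq, Finset.mem_insert, not_or]
        refine ⟨fun h' => ?_, h2avoid c (by omega)⟩
        rw [← h2bot] at h'
        have := h2inj c v'.2 (by omega) (by omega) h'
        rw [this] at hc
        omega
      have hT''T' : T'' = T' := by
        have h1 : T''ᶜ = (univ.filter fun c : Fin n => T''.card ≤ (c : ℕ)).image d₂ :=
          compl_eq_image_of_avoid d₂ T'' (by rw [ht]; exact hcond.1) (by rw [ht]; exact hcond.2)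
        have h2 : T'ᶜ = (univ.filter fun c : Fin n => T'.card ≤ (c : ℕ)).image d₂ :=
          compl_eq_image_of_avoid d₂ T' (by rw [hT'card]; exact hcond.1) hT'avoid
        rw [ht] at h1
        rw [hT'card] at h2
        exact compl_inj_iff.mp (h1.trans h2.symm)
      have hj : j'' = j' := hCinj _ _ (by rw [← hT''def, ← hT'def]; exact hT''T')
      by_cases hv1 : v''.1 = v'.1
      · -- the cell of `v''` is the bottom cell of `d₂`: it is the head entry
        have hvv : v'' = v' := Prod.ext hv1 hv2
        have hS''U : S'' = U := by
          ext j₁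
          have h1 := hrow j₁
          rw [hT''T', hT'eq, hv1] at h1
          have h2 := ite_not_mem_insert_eq T hp'T j₁
          have h3 := ite_mem_insert_eq S hpS j₁
          rw [hU] at h3
          by_cases h4 : j₁ ∈ S'' <;> by_cases h5 : j₁ ∈ U
          · exact ⟨fun _ => h5, fun _ => h4⟩
          · rw [if_pos h4] at h1; rw [if_neg h5] at h3; omega
          · rw [if_neg h4] at h1; rw [if_pos h5] at h3; omega
          · exact ⟨fun h' => absurd h' h4, fun h' => absurd h' h5⟩
        have hi : i'' = i' := hRinj _ _ (by rw [← hS''def, ← hUdef]; exact hS''U)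
        right
        rw [hi, hj, hvv]
      · -- otherwise `v''.1 ∈ T`; the cell of `v''` cannot be a `d₁`-cell (dominated backward, hence
        -- outside `T`) nor the `d₂`-cell (its row is `p'`): contradiction
        exfalso
        have hv1T : v''.1 ∈ T := by
          have h1 : v''.1 ∈ T' := hT''T' ▸ hhd
          rw [hT'eq, Finset.mem_insert] at h1
          exact h1.resolve_left hv1
        rcases (hPiff _).mp hF2 with ⟨hcs, hd⟩ | ⟨-, hd⟩
        · obtain ⟨c', hc'le, hc'⟩ := hdom2 v''.2 (by omega) hcs
          exact h2avoid c' (by omega) (by rw [hc', hd]; exact hv1T)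
        · exact hv1 (by rw [← hd, hv2, h2bot])
  · -- the tail entry evaluates to one
    intro h1
    have hi : i'' = i := congrArg Prod.fst h1
    have hj : j'' = j := congrArg (fun x => x.2.1) h1
    have hv : v'' = v := congrArg (fun x => x.2.2) h1
    have hS''S : S'' = S := by rw [hS''def, hSdef, hi]
    have hT''T : T'' = T := by rw [hT''def, hTdef, hj]
    have e1 : eval (fun w : Fin n × Fin n => if P w then (1 : k) else 0)
        ((1 - Grenet.adj k n).adjugate ∅ S'') = 1 := by
      rw [hS''S, evalSweep_grenet_W_empty k P d₁ S (fun c hc => hprim1 c hc.le)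
        (fun p c hc hP hpS' hne => hdomF p c hc.le hP (hSU hpS') hne)]
      exact if_pos ⟨fun c c' hc hc' hcc => h1inj c c' hc.le hc'.le hcc, himgS⟩
    have e2 : (if P v'' then (1 : k) else 0) = 1 := by
      rw [hv]
      exact if_pos ((hPiff _).mpr (Or.inl ⟨hq.le, h1top⟩))
    have e3 : eval (fun w : Fin n × Fin n => if P w then (1 : k) else 0)
        ((1 - Grenet.adj k n).adjugate T'' univ) = 1 := by
      rw [hT''T, evalSweep_grenet_W_univ k P d₂ T hprim2 (fun p c hc hP _ hne => hdomB p c hc hP hne)]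
      exact if_pos ⟨h2inj, h2avoid⟩
    rw [e1, e2, e3, one_mul, one_mul]
  · -- the head entry evaluates to one
    intro h1
    have hi : i'' = i' := congrArg Prod.fst h1
    have hj : j'' = j' := congrArg (fun x => x.2.1) h1
    have hv : v'' = v' := congrArg (fun x => x.2.2) h1
    have hS''U : S'' = U := by rw [hS''def, hUdef, hi]
    have hT''T' : T'' = T' := by rw [hT''def, hT'def, hj]
    have hT'card : T'.card = T.card + 1 := by rw [hT'eq, Finset.card_insert_of_notMem hp'T]
    have e1 : eval (fun w : Fin n × Fin n => if P w then (1 : k) else 0)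
        ((1 - Grenet.adj k n).adjugate ∅ S'') = 1 := by
      rw [hS''U, evalSweep_grenet_W_empty k P d₁ U (fun c hc => hprim1 c (by omega))
        (fun p c hc hP hpU' hne => hdomF p c (by omega) hP hpU' hne), hUcard]
      exact if_pos ⟨fun c c' hc hc' hcc => h1inj c c' (by omega) (by omega) hcc, himgU⟩
    have e2 : (if P v'' then (1 : k) else 0) = 1 := by
      rw [hv]
      exact if_pos ((hPiff _).mpr (Or.inr ⟨hTcard.le, h2bot⟩))
    have e3 : eval (fun w : Fin n × Fin n => if P w then (1 : k) else 0)
        ((1 - Grenet.adj k n).adjugate T'' univ) = 1 := by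
      rw [hT''T', evalSweep_grenet_W_univ k P d₂ T' (fun c hc => hprim2 c (by omega))
        (fun p c hc hP _ hne => hdomB p c (by omega) hP hne), hT'card]
      refine if_pos ⟨fun c c' hc hc' hcc => h2inj c c' (by omega) (by omega) hcc, fun c hc => ?_⟩
      rw [hT'eq, Finset.mem_insert, not_or]
      refine ⟨fun h' => ?_, h2avoid c (by omega)⟩
      rw [← h2bot] at h'
      have := h2inj c v'.2 (by omega) (by omega) h'
      rw [this] at hc
      omega
    rw [e1, e2, e3, one_mul, one_mul]

end OverlapTermBwd

end Summit.ValiantsHypothesis.Theorems.RigidityForcesSymmetry.GrenetGauge
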